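import Summits.NavierStokesRegularity.NavierStokesRegularity.Theses.ForcedAmplifier
import Literature.Analysis.FunctionSpaces.FlatTorusProofs
import Literature.Analysis.FluidPDE.NSLerayHopf
import Literature.Analysis.FluidPDE.ClassicalSolutionTorusProofs

/-!
# `ForcedAmplifier.Bridge` HOLDS — the in-cone support of route `ForcedAmplifier` (decomp-ns node N31)

Route `Summits/NavierStokesRegularity/NavierStokesRegularity/Theses/ForcedAmplifier.lean`
(ROOT DECOMPOSITION CELL decomp-ns, lens-4 g20 «THE AMPLIFIER», negative board, `closes_target` = the
erratum leaf D♯ `NavierStokesBreakdownPeriodicPressurePeriodic`):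

  D♯ ⟸ `AMP` (crux r2, residual) ∧ `QuantitativeGap` (crux r3) ∧ `Bridge` (support r9, in cone).

This file proves the support item `Bridge` (stmt-NavierStokesRegularity-28103) AS RENDERED in the route
file (def-free inlining of the lens statement `∀ ν > 0, ¬ SmoothForcedRegular ν → BreakdownAt ν`):
a failure of Tao's 2013 Conjecture 1.8 (torus form, periodic pressure, force jointly smooth on
`[0,∞) × 𝕋³`) at viscosity `ν` and one horizon `T` yields the `ν`-slice of the Clay erratum leaf D♯.
After it lands the route's open cone is exactly the two cruxes `AMP`, `QuantitativeGap`.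

It is a port of the lens proof `ForcedAmplifierBridge.bridge_holds` (decomp-ns lens-4 g25, sha256
`c174d19f…`, critic CLEARED (KERNEL) rows 251/252) onto the route declaration, with the lens's two
auxiliary definitions INLINED: the time cut-off `χ_T(t) := Real.smoothTransition (T + 1 − t)` and the
cut-off periodic force `F(t, y) := χ_T(t) • Torus.lift (f t) y`.

## Proof

Let `ν > 0` and suppose Conjecture 1.8 fails: there are `T > 0`, a smooth divergence-free `u₀` on `𝕋³`
and a force `f` jointly smooth on `[0,∞) × 𝕋³` such that NO classical solution of NS_ν(f) on
`[0,T] × 𝕋³` starts from `u₀`.  The D♯ datum is `U₀ := lift u₀` (ℤ³-periodic, smooth, divergence free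
by `isDivFree_lift_iff`) with the force `F(t, y) := χ_T(t) · f(t, proj y)` (`χ_T = 1` on `t ≤ T`, `= 0`
on `t ≥ T + 1`).  `F` is smooth on the closed half-space, has periodic slices, and has Fefferman's time
decay (9) (`hasRapidTimeDecay_of_latticePeriodic_of_vanishing`: space–time derivatives within the
half-space of a field with periodic slices are periodic, vanish where the field vanishes locally, hence
are bounded by their maximum over the compact `[0, T+1] × B̄(0,2) ⊇ [0, T+1] × repr(𝕋³)`).  If `(U, P)`
were a smooth solution on `ℝ³ × [0,∞)` from `U₀` with `U(t), P(t)` periodic for `t ≥ 0`, it is a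
classical solution on `Ici 0` (`isNavierStokesSolution_and_smooth_iff`), restricts to `Icc 0 T`, where
`F = lift ∘ f`, `U = lift ∘ (U ∘ repr)`, `P = lift ∘ (P ∘ repr)` (`Torus.lift_descend_holds`); by
`IsClassicalNSSolutionOn.to_torus_holds` the descended fields solve NS_ν(f) classically on `[0,T] × 𝕋³`
from `u₀` — contradiction. [cite: FeffermanClay2006, (D) + errata; Tao2013 arXiv:0710.1604v5 / Tao 2013
«Localisation and compactness…» Conj. 1.8; LemarieRieusset2016, §1.3]
-/

set_option linter.dupNamespace false

noncomputable section

open Set Function Filter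
open scoped ContDiff Topology Pointwise
open Literature.Analysis.FunctionSpaces Literature.Analysis.FluidPDE

namespace Summit.NavierStokesRegularity.NavierStokesRegularity.Theorems.ForcedAmplifierBridge

/-- Local notation: the flat unit 3-torus. -/
local notation "T3" => UnitAddTorus (Fin 3)
/-- Local notation: Euclidean 3-space. -/
local notation "R3" => EuclideanSpace ℝ (Fin 3)

/-! ## The smooth time cut-off `χ_T(t) = Real.smoothTransition (T + 1 − t)`

It is INLINED everywhere (no definition, no named lemmas): `χ_T` is smooth
(`Real.smoothTransition.contDiff`), `= 1` for `t ≤ T` (`Real.smoothTransition.one_of_one_le`) and `= 0`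
for `t ≥ T + 1` (`Real.smoothTransition.zero_of_nonpos`); the same profile serves the YM cone estimate
(`Literature.Barriers.QuantumFields.contDiff_coneProfile` / `coneProfile_eq_one` / `coneProfile_eq_zero`,
not imported here to keep the NS cone free of the YM barrier file). -/

/-! ## The cut-off periodic force `F(t, y) = χ_T(t) • lift (f t) y` on `ℝ³ × [0, ∞)` -/

/-- The cut-off lifted force as a function of space–time `z = (t, y)`. -/
theorem uncurry_cutForce (T : ℝ) (f : ℝ → T3 → R3) :
    uncurry (fun (t : ℝ) (y : R3) => Real.smoothTransition (T + 1 - t) • Torus.lift (f t) y) =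
      fun z : ℝ × R3 => Real.smoothTransition (T + 1 - z.1) • Torus.stLift f z := rfl

/-- The cut-off lifted force is smooth on the closed half-space (Fefferman (11)-type clause). -/
theorem cutForce_smooth (T : ℝ) {f : ℝ → T3 → R3} (hf : Torus.IsSmoothSpaceTimeOn (Ici 0) f) :
    IsSmoothOnHalfSpace
      (fun (t : ℝ) (y : R3) => Real.smoothTransition (T + 1 - t) • Torus.lift (f t) y) := by
  have h1 : ContDiffOn ℝ ∞ (fun z : ℝ × R3 => Real.smoothTransition (T + 1 - z.1))
      (Ici (0 : ℝ) ×ˢ (univ : Set R3)) :=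
    ((Real.smoothTransition.contDiff.comp (contDiff_const.sub contDiff_id)).comp
      contDiff_fst).contDiffOn
  unfold IsSmoothOnHalfSpace
  rw [uncurry_cutForce]
  exact h1.smul hf

/-- The slices of the cut-off lifted force are ℤ³-periodic (Fefferman (8)/(10)-type clause). -/
theorem cutForce_periodic (T : ℝ) (f : ℝ → T3 → R3) (t : ℝ) :
    IsLatticePeriodic (fun y : R3 => Real.smoothTransition (T + 1 - t) • Torus.lift (f t) y) := by
  intro j y
  show Real.smoothTransition (T + 1 - t) • Torus.lift (f t) (y + EuclideanSpace.single j 1) =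
    Real.smoothTransition (T + 1 - t) • Torus.lift (f t) y
  rw [Torus.isLatticePeriodic_lift (f t) j y]

/-- The cut-off lifted force vanishes identically after time `T + 1`. -/
theorem cutForce_of_gt (T : ℝ) (f : ℝ → T3 → R3) {t : ℝ} (ht : T + 1 < t) (y : R3) :
    Real.smoothTransition (T + 1 - t) • Torus.lift (f t) y = 0 := by
  rw [Real.smoothTransition.zero_of_nonpos (by linarith), zero_smul]

/-! ## Fefferman's time decay (9) for periodic forces switched off in finite time -/

/-- Translating the closed half-space `[0, ∞) × ℝ³` by `(0, a)` gives it back (the tree's copy in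
`ClayDataSpaceShift` is `private`). [folklore] -/
theorem vadd_zero_Ici_prod_univ (a : R3) :
    (((0 : ℝ), a) : ℝ × R3) +ᵥ (Ici (0 : ℝ) ×ˢ (univ : Set R3)) = Ici (0 : ℝ) ×ˢ (univ : Set R3) := by
  ext z
  simp only [Set.mem_vadd_set, mem_prod, mem_Ici, mem_univ, and_true]
  constructor
  · rintro ⟨y, hy, rfl⟩
    simpa using hy
  · intro hz
    exact ⟨(z.1, z.2 - a), by simpa using hz, by ext <;> simp⟩

/-- Space–time derivatives within the half-space of a field with ℤ³-periodic slices are ℤ³-periodic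
in the space variable (Mathlib `iteratedFDerivWithin_comp_add_left`: the translation by `(0, eⱼ)`
fixes the half-space and the field). [folklore] -/
theorem iteratedFDerivWithin_latticePeriodic {G : Type*} [NormedAddCommGroup G] [NormedSpace ℝ G]
    {Φ : ℝ × R3 → G}
    (hΦ : ∀ (t : ℝ) (j : Fin 3) (y : R3), Φ (t, y + EuclideanSpace.single j 1) = Φ (t, y))
    (n : ℕ) (t : ℝ) :
    Torus.IsLatticePeriodic
      (fun y : R3 => iteratedFDerivWithin ℝ n Φ (Ici (0 : ℝ) ×ˢ (univ : Set R3)) (t, y)) := by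
  intro j y
  dsimp only
  have hcomp : (fun z : ℝ × R3 => Φ ((((0 : ℝ), EuclideanSpace.single j (1 : ℝ)) : ℝ × R3) + z)) = Φ := by
    funext z
    obtain ⟨s, w⟩ := z
    rw [Prod.mk_add_mk, zero_add, add_comm]
    exact hΦ s j w
  have h := iteratedFDerivWithin_comp_add_left (𝕜 := ℝ) (f := Φ)
    (s := Ici (0 : ℝ) ×ˢ (univ : Set R3)) n (((0 : ℝ), EuclideanSpace.single j (1 : ℝ)) : ℝ × R3) (t, y)
  rw [hcomp, vadd_zero_Ici_prod_univ] at h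
  have hpt : ((((0 : ℝ), EuclideanSpace.single j (1 : ℝ)) : ℝ × R3) + (t, y)) =
      (t, y + EuclideanSpace.single j 1) := Prod.ext (by simp) (add_comm _ _)
  rw [hpt] at h
  exact h.symm

/-- Representatives of `𝕋³` in `[0,1)³` have norm at most `2` (the tree's copies of this bound are
`private`, e.g. in `Literature.Claims.NS.Tibola2025`). [folklore] -/
theorem norm_repr_le_two (z : T3) : ‖Torus.repr z‖ ≤ 2 := by
  have h : ∀ i, ‖Torus.repr z i‖ ^ 2 ≤ 1 := fun i => by
    have hi := Torus.repr_apply_mem_Ico z i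
    have h1 : ‖Torus.repr z i‖ ≤ 1 := by
      rw [Real.norm_eq_abs, abs_le]
      constructor <;> linarith [hi.1, hi.2]
    nlinarith [norm_nonneg (Torus.repr z i)]
  rw [EuclideanSpace.norm_eq]
  have hs : ∑ i : Fin 3, ‖Torus.repr z i‖ ^ 2 ≤ 4 :=
    calc ∑ i : Fin 3, ‖Torus.repr z i‖ ^ 2 ≤ ∑ _i : Fin 3, (1 : ℝ) :=
          Finset.sum_le_sum fun i _ => h i
      _ ≤ 4 := by norm_num
  calc Real.sqrt (∑ i : Fin 3, ‖Torus.repr z i‖ ^ 2) ≤ Real.sqrt 4 := Real.sqrt_le_sqrt hs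
    _ = 2 := by
      rw [show (4 : ℝ) = 2 ^ 2 by norm_num, Real.sqrt_sq (by norm_num)]

/-- **Fefferman's time decay (9) for a periodic force switched off in finite time.**  A field smooth
on the closed half-space whose slices are ℤ³-periodic and which vanishes identically for `t > T + 1`
has rapid time decay: its space–time derivatives within the half-space vanish for `t > T + 1`
(`Filter.EventuallyEq.iteratedFDerivWithin_eq`) and are ℤ³-periodic in space, hence bounded on
`[0, T + 1] × ℝ³` by their maximum on the compact `[0, T + 1] × B̄(0, 2)`. [cite: FeffermanClay2006, (9)] -/
theorem hasRapidTimeDecay_of_latticePeriodic_of_vanishing {T : ℝ} (hT : 0 ≤ T) {F : ℝ → R3 → R3}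
    (hF : IsSmoothOnHalfSpace F)
    (hper : ∀ (t : ℝ) (j : Fin 3) (y : R3), F t (y + EuclideanSpace.single j 1) = F t y)
    (hzero : ∀ t : ℝ, T + 1 < t → ∀ y : R3, F t y = 0) : HasRapidTimeDecay F := by
  intro n K
  have hU : UniqueDiffOn ℝ (Ici (0 : ℝ) ×ˢ (univ : Set R3)) :=
    (uniqueDiffOn_Ici 0).prod uniqueDiffOn_univ
  have hcont : ContinuousOn
      (iteratedFDerivWithin ℝ n (uncurry F) (Ici (0 : ℝ) ×ˢ (univ : Set R3)))
      (Ici (0 : ℝ) ×ˢ (univ : Set R3)) :=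
    hF.continuousOn_iteratedFDerivWithin (m := n) (by exact_mod_cast le_top) hU
  have hKc : IsCompact (Icc (0 : ℝ) (T + 1) ×ˢ Metric.closedBall (0 : R3) 2) :=
    isCompact_Icc.prod (isCompact_closedBall _ _)
  have hKH : Icc (0 : ℝ) (T + 1) ×ˢ Metric.closedBall (0 : R3) 2 ⊆ Ici (0 : ℝ) ×ˢ (univ : Set R3) :=
    prod_mono Icc_subset_Ici_self (subset_univ _)
  obtain ⟨C, hC⟩ := hKc.exists_bound_of_continuousOn (hcont.mono hKH)
  have hper' : ∀ (t : ℝ) (j : Fin 3) (y : R3),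
      uncurry F (t, y + EuclideanSpace.single j 1) = uncurry F (t, y) :=
    fun t j y => hper t j y
  refine ⟨(2 + T) ^ K * max C 0, fun t ht x => ?_⟩
  by_cases htT : t ≤ T + 1
  · obtain ⟨k, hk⟩ := Torus.exists_repr_proj_eq_add_latticeVec_holds x
    have hperD := iteratedFDerivWithin_latticePeriodic hper' n t
    have heq : iteratedFDerivWithin ℝ n (uncurry F) (Ici (0 : ℝ) ×ˢ (univ : Set R3)) (t, x) =
        iteratedFDerivWithin ℝ n (uncurry F) (Ici (0 : ℝ) ×ˢ (univ : Set R3))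
          (t, Torus.repr (Torus.proj x)) := by
      rw [hk]
      exact (Torus.IsLatticePeriodic.add_latticeVec_holds hperD x k).symm
    have hmem : ((t, Torus.repr (Torus.proj x)) : ℝ × R3) ∈
        Icc (0 : ℝ) (T + 1) ×ˢ Metric.closedBall (0 : R3) 2 :=
      mk_mem_prod ⟨ht, htT⟩ (by
        rw [Metric.mem_closedBall, dist_zero_right]
        exact norm_repr_le_two _)
    have h1 : ‖iteratedFDerivWithin ℝ n (uncurry F) (Ici (0 : ℝ) ×ˢ (univ : Set R3)) (t, x)‖
        ≤ max C 0 := by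
      rw [heq]
      exact (hC _ hmem).trans (le_max_left _ _)
    have h2 : (1 + t) ^ K ≤ (2 + T) ^ K :=
      pow_le_pow_left₀ (by linarith) (by linarith) K
    exact mul_le_mul h2 h1 (norm_nonneg _) (pow_nonneg (by linarith) K)
  · have hgt : T + 1 < t := lt_of_not_ge htT
    have hev0 : uncurry F =ᶠ[𝓝 ((t, x) : ℝ × R3)] fun _ => (0 : R3) := by
      have hopen : IsOpen {z : ℝ × R3 | T + 1 < z.1} := isOpen_lt continuous_const continuous_fst
      filter_upwards [hopen.mem_nhds (show ((t, x) : ℝ × R3) ∈ {z : ℝ × R3 | T + 1 < z.1} from hgt)]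
        with z hz
      exact hzero z.1 hz z.2
    have hz0 : iteratedFDerivWithin ℝ n (uncurry F) (Ici (0 : ℝ) ×ˢ (univ : Set R3)) (t, x) = 0 := by
      rw [Filter.EventuallyEq.iteratedFDerivWithin_eq (𝕜 := ℝ) (hev0.filter_mono nhdsWithin_le_nhds)
        hev0.eq_of_nhds n]
      simp
    rw [hz0, norm_zero, mul_zero]
    exact mul_nonneg (pow_nonneg (by linarith) K) (le_max_right _ _)

/-- Time decay (9) of the cut-off lifted force. -/
theorem cutForce_decay {T : ℝ} (hT : 0 ≤ T) {f : ℝ → T3 → R3}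
    (hf : Torus.IsSmoothSpaceTimeOn (Ici 0) f) :
    HasRapidTimeDecay
      (fun (t : ℝ) (y : R3) => Real.smoothTransition (T + 1 - t) • Torus.lift (f t) y) :=
  hasRapidTimeDecay_of_latticePeriodic_of_vanishing hT (cutForce_smooth T hf)
    (fun t j y => cutForce_periodic T f t j y) (fun _ ht y => cutForce_of_gt T f ht y)

/-! ## Whole-space bookkeeping -/

/-- A classical solution on the time set `S` stays one when force, velocity AND pressure are
modified at times outside `S` (all clauses only see the slices at `t ∈ S` and the time derivative
WITHIN `S`).  Joint three-slot version of the tree's one-slot lemmas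
`IsClassicalNSSolutionOn.congr_force` (`IsometryInvariance`) and `IsClassicalNSSolutionOn.congr_velocity`
(`NSLerayStrongLocalExistence`) — the tree has no pressure-slot variant, and `bridge_holds` replaces all
three fields at once. [folklore] -/
theorem classicalNS_congr {S : Set ℝ} {ν : ℝ} {f f' u u' : ℝ → R3 → R3} {p p' : ℝ → R3 → ℝ}
    (h : IsClassicalNSSolutionOn S ν f u p) (hf : ∀ t ∈ S, f' t = f t) (hu : ∀ t ∈ S, u' t = u t)
    (hp : ∀ t ∈ S, p' t = p t) : IsClassicalNSSolutionOn S ν f' u' p' where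
  smooth_velocity :=
    h.smooth_velocity.congr fun z hz => by
      change u' z.1 z.2 = u z.1 z.2
      rw [hu z.1 (mem_prod.1 hz).1]
  smooth_pressure :=
    h.smooth_pressure.congr fun z hz => by
      change p' z.1 z.2 = p z.1 z.2
      rw [hp z.1 (mem_prod.1 hz).1]
  momentum t ht x := by
    have h1 : timeDerivWithin S u' t x = timeDerivWithin S u t x := by
      simp only [timeDerivWithin_apply]
      exact derivWithin_congr (fun s hs => by show u' s x = u s x; rw [hu s hs])
        (by show u' t x = u t x; rw [hu t ht])
    have h2 := h.momentum t ht x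
    rw [← hu t ht, ← hp t ht, ← hf t ht] at h2
    rw [h1]
    exact h2
  divFree t ht := by
    rw [hu t ht]
    exact h.divFree t ht

/-! ## The support `Bridge` holds -/

/-- **`Bridge` HOLDS** (support item stmt-NavierStokesRegularity-28103 of route `ForcedAmplifier`,
rank 9, in the cone of `closes`): a failure of Tao's Conjecture 1.8 at viscosity `ν` on `𝕋³` produces
the `ν`-slice of the Clay erratum leaf D♯.
[cite: FeffermanClay2006, (D) + errata; Tao2013, Conj. 1.8; LemarieRieusset2016, §1.3] -/
theorem bridge_holds : Theses.ForcedAmplifier.Bridge := by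
  intro ν hν hnot
  push Not at hnot
  obtain ⟨T, hT, u₀, hu₀, hdiv₀, f, hf, hno⟩ := hnot
  have hdivR : NSWave0.IsDivFree (Torus.lift u₀) :=
    (isDivFree_lift_iff (hu₀.isContDiff (by simp))).2 hdiv₀
  refine ⟨Torus.lift u₀,
    fun (t : ℝ) (y : R3) => Real.smoothTransition (T + 1 - t) • Torus.lift (f t) y,
    hu₀, hdivR, Torus.isLatticePeriodic_lift u₀, cutForce_smooth T hf,
    fun t _ => cutForce_periodic T f t, cutForce_decay hT.le hf, ?_⟩
  rintro ⟨U, P, hU, hP, hns, hper⟩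
  have hcl : IsClassicalNSSolutionOn (Ici 0) ν
      (fun (t : ℝ) (y : R3) => Real.smoothTransition (T + 1 - t) • Torus.lift (f t) y) U P :=
    (isNavierStokesSolution_and_smooth_iff.1 ⟨hns, hU, hP⟩).1
  have hU0 : U 0 = Torus.lift u₀ := hns.initial
  have hclT : IsClassicalNSSolutionOn (Icc 0 T) ν
      (fun (t : ℝ) (y : R3) => Real.smoothTransition (T + 1 - t) • Torus.lift (f t) y) U P :=
    hcl.mono Icc_subset_Ici_self (uniqueDiffOn_Icc hT)
  -- the descended fields
  set uT : ℝ → T3 → R3 := fun t z => U t (Torus.repr z) with huT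
  set pT : ℝ → T3 → ℝ := fun t z => P t (Torus.repr z) with hpT
  have hUlift : ∀ t ∈ Icc (0 : ℝ) T, Torus.lift (uT t) = U t := fun t ht =>
    Torus.lift_descend_holds (U t) (hper t ht.1).1
  have hPlift : ∀ t ∈ Icc (0 : ℝ) T, Torus.lift (pT t) = P t := fun t ht =>
    Torus.lift_descend_holds (P t) (hper t ht.1).2
  have hFlift : ∀ t ∈ Icc (0 : ℝ) T, Torus.lift (f t) =
      (fun (t : ℝ) (y : R3) => Real.smoothTransition (T + 1 - t) • Torus.lift (f t) y) t :=
    fun t ht => by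
    funext y
    show Torus.lift (f t) y = Real.smoothTransition (T + 1 - t) • Torus.lift (f t) y
    rw [Real.smoothTransition.one_of_one_le (by linarith [ht.2]), one_smul]
  have hcl' : IsClassicalNSSolutionOn (Icc 0 T) ν (fun t => Torus.lift (f t))
      (fun t => Torus.lift (uT t)) (fun t => Torus.lift (pT t)) :=
    classicalNS_congr hclT hFlift hUlift hPlift
  have htor : Torus.IsClassicalNSSolutionOn (Icc 0 T) ν f uT pT :=
    IsClassicalNSSolutionOn.to_torus_holds hcl'
  have h0 : uT 0 = u₀ := by
    funext z
    show U 0 (Torus.repr z) = u₀ z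
    rw [hU0]
    exact Torus.lift_repr u₀ z
  exact hno uT pT htor h0

end Summit.NavierStokesRegularity.NavierStokesRegularity.Theorems.ForcedAmplifierBridge

end
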